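import Literature.AnabelianGeometry.AbsoluteAnabelian.CyclotomicSynchronizationCor110iaProofs
import Literature.NumberTheory.GaloisRepresentations.BrauerTower
import HarnessLib

/-!
# [AbsTopIII] Cor. 1.10 (i)(a): `H²(G_k, μ_Ẑ(G_k))` as the DIVISIBILITY-indexed limit `lim_{n ≥ 1} H²(G_k, μ_n)`

S. Mochizuki, *Topics in Absolute Anabelian Geometry III*, Cor. 1.10 (i)(a) p. 42 (kurims render
`url-5493eb38cbb7`): "the natural isomorphism `H²(G_k, μ_Ẑ(G_k)) ⥲ Ẑ`"; Prop. 3.2 (i) p. 71 l. 57–60: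
"applying the functor `Hom(ℚ/ℤ, −)` to … `H²(G, μ_{ℚ/ℤ}(M_TM)) ⥲ ℚ/ℤ`".  In the tree the continuous `H²` of
the Galois cyclotome is computed along the FACTORIAL chain `(i+1)!` (abc-iut-L4-t17: `galCyclotomeTower`,
`DiscreteTowerPresentation.limitClassesEquiv`, `limitClassesEquivZModChain`), whereas the `Hom(ℚ/ℤ, −)` side
of Prop. 3.2 (i) (`Prop121vii.H2MuQZ`, `EtaleTheta.cyclotome = Λ(−)`) produces families indexed by ALL positive
integers under divisibility.  This file bridges the two index categories (cofinality bookkeeping, one degree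
above `IsChainCompatible.pow_div_eq_pow_div` of `GaloisCyclotomeTowerLevels.lean`):
* `muPowHomOfDvd k h : μ_N(k̄) → μ_n(k̄)` for `n ∣ N` in `ℕ+` (the tree's `muPowHom`, exponent `N / n`) with
  identity / transitivity lemmas and the induced maps on `H²` (pointwise functoriality of Mathlib's
  `ContinuousCohomology.map` via the tree's `map_comp_apply_of`);
* `H2PowCompatible k` — the inverse system `(H²(G_k, μ_n(k̄)), H²(μ_N ↠ μ_n))_{n ≥ 1}` (any field `k`);
* `h2PowCompatibleEquivLimitClasses φ hφ : H2PowCompatible k ≃+ (galCyclotomeTower φ hφ).limitClasses` —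
  restriction to the factorial chain / `cycLevel`-cofinal extension (`limitClassesExtend`);
* for a `p`-adic local field `K`: `galCyclotomeH2EquivPowCompatible K φ hφ : H²(G_K, μ_Ẑ(G_K)) ≃+
  H2PowCompatible K` with the CANONICAL component formula `(… c) n = H²(cycProj n) c` for every `n ≥ 1`, and
  the residue maps `inv_n` (`Prop121vii.invLevel`) on the whole divisibility system
  (`invLevel_castHom_of_mem_H2PowCompatible`, `limitClassesEquivZModChain_restrict_coe`).
Inputs BY NAME: `galCyclotomeTower`, `cycProj`, `componentUnit_eq_pow_of_dvd`, `finite_H1_galCyclotomeTower`,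
`limitClassesEquivZModChain` (abc-iut-L4-t17), `invLevel_muPowHom_hom`, `DiscreteTowerPresentation.limitClassesEquiv`.
HONEST FRAMING: classical, undisputed profinite / Galois-cohomology bookkeeping (abc-iut cell, layer L4, sub-DAG
[AbsTopIII] Prop. 3.2 (i), genuine-`H²` chain step (S3)); nothing here bears on [IUTchIII] Cor. 3.12; no side taken.

## References
* [MochizukiAbsTopIII2015] S. Mochizuki, *Topics in Absolute Anabelian Geometry III*, Cor. 1.10 (i) p. 42,
  Prop. 3.2 (i) p. 71.
* [NeukirchSchmidtWingberg2008] J. Neukirch, A. Schmidt, K. Wingberg, *Cohomology of Number Fields*, (2.7.5).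
-/

noncomputable section

open CategoryTheory Function

universe u

namespace Literature.AnabelianGeometry.AbsoluteAnabelian

open Field
open Literature.NumberTheory.GaloisRepresentations
open Literature.NumberTheory.GaloisRepresentations.DiscreteGaloisModule

/-! ### Pointwise functoriality of the induced maps on continuous cohomology -/

section CohomologyMap

variable {k : Type u} [Field k]

/-- If `h = g ∘ f` pointwise (morphisms of topological representations of `G_k`), then
`Hⁿ(h) = Hⁿ(g) ∘ Hⁿ(f)` on classes. [cite: NeukirchSchmidtWingberg2008, Thm (2.7.5)] -/
theorem cohomologyMap_hom_apply_of_comp {A B C : TopRep.{u} ℤ (absoluteGaloisGroup k)}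
    (f : A ⟶ B) (g : B ⟶ C) (h : A ⟶ C) (hh : ∀ v, h.hom v = g.hom (f.hom v)) (q : ℕ)
    (x : continuousCohomology q A) :
    (cohomologyMap h q).hom x = (cohomologyMap g q).hom ((cohomologyMap f q).hom x) :=
  map_comp_apply_of (ContinuousMonoidHom.id _) (ContinuousMonoidHom.id _) (ContinuousMonoidHom.id _)
    (fun _ => rfl) (resIdHom f) (resIdHom g) (resIdHom h) (fun v => hh v) q x

/-- If `f = id` pointwise, then `Hⁿ(f) = id` on classes. [cite: NeukirchSchmidtWingberg2008, Thm (2.7.5)] -/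
theorem cohomologyMap_hom_apply_of_id {A : TopRep.{u} ℤ (absoluteGaloisGroup k)} (f : A ⟶ A)
    (hf : ∀ v, f.hom v = v) (q : ℕ) (x : continuousCohomology q A) :
    (cohomologyMap f q).hom x = x := by
  have h : cohomologyMap f q = 𝟙 _ := map_id_eq_id (resIdHom f) hf q
  rw [h]
  rfl

end CohomologyMap

/-! ### The power maps along divisibilities of positive levels -/

section MuPowDvd

variable (k : Type u) [Field k]

/-- `muPowHom` does not depend on the chosen exponent (`n ≠ 0`).
[cite: MochizukiAbsTopIII2015, Cor 1.10 (i) p.41] -/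
theorem muPowHom_ext {N n d d' : ℕ} (hn : n ≠ 0) (h : n * d = N) (h' : n * d' = N) :
    muPowHom k N n d h = muPowHom k N n d' h' := by
  obtain rfl : d = d' := Nat.eq_of_mul_eq_mul_left (Nat.pos_of_ne_zero hn) (h.trans h'.symm)
  rfl

/-- **The power map `μ_N(k̄) → μ_n(k̄)`, `ζ ↦ ζ^{N/n}`, along a divisibility `n ∣ N` of positive
levels** (the tree's `muPowHom` with the canonical exponent). [cite: MochizukiAbsTopIII2015, Cor 1.10 (i) p.41] -/
def muPowHomOfDvd {n N : ℕ+} (h : (n : ℕ) ∣ (N : ℕ)) : (mu k (N : ℕ)).toTopRep ⟶ (mu k (n : ℕ)).toTopRep :=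
  muPowHom k N n ((N : ℕ) / n) (Nat.mul_div_cancel' h)

/-- `muPowHomOfDvd` on elements: `muVal (ζ ↦ ζ^{N/n})`. [cite: MochizukiAbsTopIII2015, Cor 1.10 (i) p.41] -/
@[simp] theorem muVal_muPowHomOfDvd_hom {n N : ℕ+} (h : (n : ℕ) ∣ (N : ℕ)) (v : MuCarrier k N) :
    muVal k n ((muPowHomOfDvd k h).hom v) = muVal k N v ^ ((N : ℕ) / n) := rfl

/-- The power map along `n ∣ n` is the identity (pointwise). [cite: MochizukiAbsTopIII2015, Cor 1.10 (i) p.41] -/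
theorem muPowHomOfDvd_refl_hom_apply (n : ℕ+) (v : MuCarrier k n) :
    (muPowHomOfDvd k (dvd_refl (n : ℕ))).hom v = v :=
  muVal_injective k n (by rw [muVal_muPowHomOfDvd_hom, Nat.div_self n.pos, pow_one])

/-- Exponent bookkeeping: `(M/N)·(N/n) = M/n` for `n ∣ N ∣ M`, `N ≠ 0`. [folklore] -/
private theorem div_mul_div_cancel_of_dvd {n N M : ℕ} (hN : 0 < N) (h₁ : n ∣ N) (h₂ : N ∣ M) :
    M / N * (N / n) = M / n := by
  rw [Nat.div_mul_div_comm h₂ h₁, mul_comm N n, Nat.mul_div_mul_right _ _ hN]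

/-- **Transitivity**: `(ζ^{M/N})^{N/n} = ζ^{M/n}` — the power maps compose (pointwise).
[cite: MochizukiAbsTopIII2015, Cor 1.10 (i) p.41] -/
theorem muPowHomOfDvd_hom_comp_apply {n N M : ℕ+} (h₁ : (n : ℕ) ∣ (N : ℕ)) (h₂ : (N : ℕ) ∣ (M : ℕ))
    (v : MuCarrier k M) :
    (muPowHomOfDvd k (h₁.trans h₂)).hom v = (muPowHomOfDvd k h₁).hom ((muPowHomOfDvd k h₂).hom v) :=
  muVal_injective k n (by
    rw [muVal_muPowHomOfDvd_hom, muVal_muPowHomOfDvd_hom, muVal_muPowHomOfDvd_hom, ← pow_mul,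
      div_mul_div_cancel_of_dvd N.pos h₁ h₂])

/-- On `H²`: `H²(μ_M ↠ μ_n) = H²(μ_N ↠ μ_n) ∘ H²(μ_M ↠ μ_N)` for `n ∣ N ∣ M`.
[cite: MochizukiAbsTopIII2015, Cor 1.10 (i) p.42] -/
theorem cohomologyMap_muPowHomOfDvd_trans {n N M : ℕ+} (h₁ : (n : ℕ) ∣ (N : ℕ)) (h₂ : (N : ℕ) ∣ (M : ℕ))
    (q : ℕ) (x : continuousCohomology q (mu k (M : ℕ)).toTopRep) :
    (cohomologyMap (muPowHomOfDvd k (h₁.trans h₂)) q).hom x =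
      (cohomologyMap (muPowHomOfDvd k h₁) q).hom ((cohomologyMap (muPowHomOfDvd k h₂) q).hom x) :=
  cohomologyMap_hom_apply_of_comp _ _ _ (muPowHomOfDvd_hom_comp_apply k h₁ h₂) q x

/-- On `H²`: `H²(μ_n ↠ μ_n) = id`. [cite: MochizukiAbsTopIII2015, Cor 1.10 (i) p.42] -/
theorem cohomologyMap_muPowHomOfDvd_refl (n : ℕ+) (q : ℕ)
    (x : continuousCohomology q (mu k (n : ℕ)).toTopRep) :
    (cohomologyMap (muPowHomOfDvd k (dvd_refl (n : ℕ))) q).hom x = x :=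
  cohomologyMap_hom_apply_of_id _ (muPowHomOfDvd_refl_hom_apply k n) q x

/-- Independence of the divisibility witness (for rewriting). [cite: MochizukiAbsTopIII2015, Cor 1.10 (i) p.42] -/
theorem cohomologyMap_muPowHomOfDvd_congr {n N : ℕ+} (h h' : (n : ℕ) ∣ (N : ℕ)) (q : ℕ)
    (x : continuousCohomology q (mu k (N : ℕ)).toTopRep) :
    (cohomologyMap (muPowHomOfDvd k h) q).hom x = (cohomologyMap (muPowHomOfDvd k h') q).hom x := rfl

end MuPowDvd

/-! ### The divisibility-indexed inverse system of the `H²(G_k, μ_n(k̄))` -/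

section PowCompatible

variable (k : Type u) [Field k]

/-- **`lim_{n ∈ ℕ≥1} H²(G_k, μ_n(k̄))` along the power maps**: families of classes `(c_n)_{n ≥ 1}`,
`c_n ∈ H²(G_k, μ_n(k̄))`, with `H²(μ_N ↠ μ_n) c_N = c_n` whenever `n ∣ N` — the inverse system whose limit is
`H²(G_k, μ_Ẑ(G_k))` ([AbsTopIII] Cor. 1.10 (i)(a); `μ_Ẑ = Hom(ℚ/ℤ, μ_{ℚ/ℤ}) = lim_n μ_n` over ALL `n`), as an
additive subgroup of `∏_n H²(G_k, μ_n)`. [cite: MochizukiAbsTopIII2015, Cor 1.10 (i) p.42] -/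
def H2PowCompatible : AddSubgroup (∀ n : ℕ+, continuousCohomology 2 (mu k (n : ℕ)).toTopRep) where
  carrier := {c | ∀ ⦃n N : ℕ+⦄ (h : (n : ℕ) ∣ (N : ℕ)), (cohomologyMap (muPowHomOfDvd k h) 2).hom (c N) = c n}
  zero_mem' n N h := by
    change (cohomologyMap (muPowHomOfDvd k h) 2).hom 0 = 0
    exact map_zero _
  add_mem' {a b} ha hb n N h := by
    change (cohomologyMap (muPowHomOfDvd k h) 2).hom (a N + b N) = a n + b n
    rw [map_add, ha h, hb h]
  neg_mem' {a} ha n N h := by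
    change (cohomologyMap (muPowHomOfDvd k h) 2).hom (-a N) = -a n
    rw [map_neg, ha h]

/-- Membership in `H2PowCompatible`. [cite: MochizukiAbsTopIII2015, Cor 1.10 (i) p.42] -/
theorem mem_H2PowCompatible_iff (c : ∀ n : ℕ+, continuousCohomology 2 (mu k (n : ℕ)).toTopRep) :
    c ∈ H2PowCompatible k ↔
      ∀ ⦃n N : ℕ+⦄ (h : (n : ℕ) ∣ (N : ℕ)), (cohomologyMap (muPowHomOfDvd k h) 2).hom (c N) = c n :=
  Iff.rfl

/-- The compatibility of a member of `H2PowCompatible`, applied. [cite: MochizukiAbsTopIII2015, Cor 1.10 (i) p.42] -/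
theorem H2PowCompatible.compat (c : H2PowCompatible k) {n N : ℕ+} (h : (n : ℕ) ∣ (N : ℕ)) :
    (cohomologyMap (muPowHomOfDvd k h) 2).hom ((c : ∀ n : ℕ+, continuousCohomology 2 (mu k (n : ℕ)).toTopRep) N) =
      (c : ∀ n : ℕ+, continuousCohomology 2 (mu k (n : ℕ)).toTopRep) n :=
  c.2 h

end PowCompatible

/-! ### The bridge to the factorial tower `galCyclotomeTower` -/

section Bridge

variable {k : Type u} [Field k] [CharZero k]

variable (φ : muQZ (absoluteGaloisGroup k) ≃+ Additive (CommGroup.torsion (AlgebraicClosure k)ˣ))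
  (hφ : ∀ (σ : absoluteGaloisGroup k) (x : muQZ (absoluteGaloisGroup k)),
    (((Additive.toMul (φ (σ • x)) : CommGroup.torsion (AlgebraicClosure k)ˣ) :
        (AlgebraicClosure k)ˣ) : AlgebraicClosure k) =
      σ • (((Additive.toMul (φ x) : CommGroup.torsion (AlgebraicClosure k)ˣ) :
        (AlgebraicClosure k)ˣ) : AlgebraicClosure k))

/-- The transition map of `galCyclotomeTower` at level `i` is the canonical power map along
`(i+1)! ∣ (i+2)!`. [cite: MochizukiAbsTopIII2015, Cor 1.10 (i) p.42] -/
theorem galCyclotomeTower_tr_eq (i : ℕ) :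
    (galCyclotomeTower φ hφ).tr i = muPowHomOfDvd k (cycLevel_dvd (Nat.le_succ i)) :=
  muPowHom_ext k (cycLevel i).ne_zero _ _

/-- Membership in `limitClasses` of the cyclotome tower, read through the canonical power maps.
[cite: MochizukiAbsTopIII2015, Cor 1.10 (i) p.42] -/
theorem limitClasses_compat (s : (galCyclotomeTower φ hφ).limitClasses) (i : ℕ) :
    (cohomologyMap (muPowHomOfDvd k (cycLevel_dvd (Nat.le_succ i))) 2).hom
        ((s : ∀ i, continuousCohomology 2 ((galCyclotomeTower φ hφ).obj i)) (i + 1)) =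
      (s : ∀ i, continuousCohomology 2 ((galCyclotomeTower φ hφ).obj i)) i := by
  rw [← galCyclotomeTower_tr_eq φ hφ i]
  exact s.2 i

/-- **Iterated compatibility** along the chain: `H²(μ_{(j+1)!} ↠ μ_{(i+1)!}) s_j = s_i` for `i ≤ j`.
[cite: MochizukiAbsTopIII2015, Cor 1.10 (i) p.42] -/
theorem limitClasses_pow_div (s : (galCyclotomeTower φ hφ).limitClasses) {i j : ℕ} (hij : i ≤ j) :
    (cohomologyMap (muPowHomOfDvd k (cycLevel_dvd hij)) 2).hom
        ((s : ∀ i, continuousCohomology 2 ((galCyclotomeTower φ hφ).obj i)) j) =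
      (s : ∀ i, continuousCohomology 2 ((galCyclotomeTower φ hφ).obj i)) i := by
  induction hij with
  | refl => exact cohomologyMap_muPowHomOfDvd_refl k (cycLevel i) 2 _
  | @step j hij ih =>
    rw [cohomologyMap_muPowHomOfDvd_congr k (cycLevel_dvd (Nat.le.step hij))
        ((cycLevel_dvd hij).trans (cycLevel_dvd (Nat.le_succ j))),
      cohomologyMap_muPowHomOfDvd_trans k (cycLevel_dvd hij) (cycLevel_dvd (Nat.le_succ j)),
      limitClasses_compat φ hφ s j, ih]

/-- **Level independence**: `H²(μ_{(i+1)!} ↠ μ_n) s_i` does not depend on the level `i` with `n ∣ (i+1)!`.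
[cite: MochizukiAbsTopIII2015, Cor 1.10 (i) p.42] -/
theorem limitClasses_pow_dvd (s : (galCyclotomeTower φ hφ).limitClasses) {n : ℕ+} {i j : ℕ}
    (hi : (n : ℕ) ∣ (cycLevel i : ℕ)) (hj : (n : ℕ) ∣ (cycLevel j : ℕ)) :
    (cohomologyMap (muPowHomOfDvd k hi) 2).hom
        ((s : ∀ i, continuousCohomology 2 ((galCyclotomeTower φ hφ).obj i)) i) =
      (cohomologyMap (muPowHomOfDvd k hj) 2).hom
        ((s : ∀ i, continuousCohomology 2 ((galCyclotomeTower φ hφ).obj i)) j) := by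
  wlog hij : i ≤ j generalizing i j
  · exact (this hj hi (le_of_not_ge hij)).symm
  rw [← limitClasses_pow_div φ hφ s hij, ← cohomologyMap_muPowHomOfDvd_trans k hi (cycLevel_dvd hij)]

/-- **Restriction to the factorial chain**: a power-compatible family over all positive levels gives a
compatible family of classes along `galCyclotomeTower`. [cite: MochizukiAbsTopIII2015, Cor 1.10 (i) p.42] -/
def h2PowCompatibleRestrict : H2PowCompatible k →+ (galCyclotomeTower φ hφ).limitClasses where
  toFun c := ⟨fun i => (c : ∀ n : ℕ+, continuousCohomology 2 (mu k (n : ℕ)).toTopRep) (cycLevel i),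
    fun i => by
      rw [galCyclotomeTower_tr_eq φ hφ i]
      exact c.2 (cycLevel_dvd (Nat.le_succ i))⟩
  map_zero' := rfl
  map_add' _ _ := rfl

/-- Components of the restriction. [cite: MochizukiAbsTopIII2015, Cor 1.10 (i) p.42] -/
@[simp] theorem h2PowCompatibleRestrict_apply_coe (c : H2PowCompatible k) (i : ℕ) :
    (h2PowCompatibleRestrict φ hφ c : ∀ i, continuousCohomology 2 ((galCyclotomeTower φ hφ).obj i)) i =
      (c : ∀ n : ℕ+, continuousCohomology 2 (mu k (n : ℕ)).toTopRep) (cycLevel i) := rfl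

/-- The would-be `n`-th component of the extension of a chain-compatible family of classes:
`H²(μ_{(j+1)!} ↠ μ_n) s_j` at the first level `j = n - 1` with `n ∣ (j+1)!`.
[cite: MochizukiAbsTopIII2015, Cor 1.10 (i) p.42] -/
def limitClassesExtendFun (s : (galCyclotomeTower φ hφ).limitClasses) (n : ℕ+) :
    continuousCohomology 2 (mu k (n : ℕ)).toTopRep :=
  (cohomologyMap (muPowHomOfDvd k (dvd_cycLevel_natPred n)) 2).hom
    ((s : ∀ i, continuousCohomology 2 ((galCyclotomeTower φ hφ).obj i)) n.natPred)

/-- The extension computed at ANY admissible level. [cite: MochizukiAbsTopIII2015, Cor 1.10 (i) p.42] -/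
theorem limitClassesExtendFun_eq (s : (galCyclotomeTower φ hφ).limitClasses) (n : ℕ+) {i : ℕ}
    (hi : (n : ℕ) ∣ (cycLevel i : ℕ)) :
    limitClassesExtendFun φ hφ s n =
      (cohomologyMap (muPowHomOfDvd k hi) 2).hom
        ((s : ∀ i, continuousCohomology 2 ((galCyclotomeTower φ hφ).obj i)) i) :=
  limitClasses_pow_dvd φ hφ s (dvd_cycLevel_natPred n) hi

/-- The extension IS power-compatible over all positive levels. [cite: MochizukiAbsTopIII2015, Cor 1.10 (i) p.42] -/
theorem limitClassesExtendFun_mem (s : (galCyclotomeTower φ hφ).limitClasses) :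
    limitClassesExtendFun φ hφ s ∈ H2PowCompatible k := by
  intro n N h
  rw [limitClassesExtendFun_eq φ hφ s n (h.trans (dvd_cycLevel_natPred N)), limitClassesExtendFun,
    cohomologyMap_muPowHomOfDvd_trans k h (dvd_cycLevel_natPred N)]

/-- **Cofinal extension**: a compatible family of classes along the factorial chain extends to a
power-compatible family over all positive levels. [cite: MochizukiAbsTopIII2015, Cor 1.10 (i) p.42] -/
def limitClassesExtend : (galCyclotomeTower φ hφ).limitClasses →+ H2PowCompatible k where
  toFun s := ⟨limitClassesExtendFun φ hφ s, limitClassesExtendFun_mem φ hφ s⟩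
  map_zero' := Subtype.ext (funext fun n => by
    change (cohomologyMap (muPowHomOfDvd k (dvd_cycLevel_natPred n)) 2).hom 0 = 0
    exact map_zero _)
  map_add' s s' := Subtype.ext (funext fun n => by
    change (cohomologyMap (muPowHomOfDvd k (dvd_cycLevel_natPred n)) 2).hom (_ + _) = _ + _
    exact map_add _ _ _)

/-- Components of the extension (at any admissible level). [cite: MochizukiAbsTopIII2015, Cor 1.10 (i) p.42] -/
theorem limitClassesExtend_apply_coe (s : (galCyclotomeTower φ hφ).limitClasses) (n : ℕ+) {i : ℕ}
    (hi : (n : ℕ) ∣ (cycLevel i : ℕ)) :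
    (limitClassesExtend φ hφ s : ∀ n : ℕ+, continuousCohomology 2 (mu k (n : ℕ)).toTopRep) n =
      (cohomologyMap (muPowHomOfDvd k hi) 2).hom
        ((s : ∀ i, continuousCohomology 2 ((galCyclotomeTower φ hφ).obj i)) i) :=
  limitClassesExtendFun_eq φ hφ s n hi

/-- Extending and then restricting is the identity. [cite: MochizukiAbsTopIII2015, Cor 1.10 (i) p.42] -/
theorem h2PowCompatibleRestrict_limitClassesExtend (s : (galCyclotomeTower φ hφ).limitClasses) :
    h2PowCompatibleRestrict φ hφ (limitClassesExtend φ hφ s) = s :=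
  Subtype.ext (funext fun i => by
    rw [h2PowCompatibleRestrict_apply_coe, limitClassesExtend_apply_coe φ hφ s (cycLevel i)
      (dvd_refl _)]
    exact cohomologyMap_muPowHomOfDvd_refl k (cycLevel i) 2 _)

/-- Restricting and then extending is the identity. [cite: MochizukiAbsTopIII2015, Cor 1.10 (i) p.42] -/
theorem limitClassesExtend_h2PowCompatibleRestrict (c : H2PowCompatible k) :
    limitClassesExtend φ hφ (h2PowCompatibleRestrict φ hφ c) = c :=
  Subtype.ext (funext fun n => by
    rw [limitClassesExtend_apply_coe φ hφ _ n (dvd_cycLevel_natPred n), h2PowCompatibleRestrict_apply_coe]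
    exact c.2 (dvd_cycLevel_natPred n))

/-- **The cofinality bridge `lim_{n ∈ ℕ≥1} H²(G_k, μ_n) ≃+ lim_i H²(G_k, μ_{(i+1)!})`**: restriction to the
factorial chain is an additive equivalence onto abc-iut-L4-t17's `limitClasses` of `galCyclotomeTower`,
with inverse the cofinal extension. [cite: MochizukiAbsTopIII2015, Cor 1.10 (i) p.42] -/
def h2PowCompatibleEquivLimitClasses : H2PowCompatible k ≃+ (galCyclotomeTower φ hφ).limitClasses :=
  { h2PowCompatibleRestrict φ hφ with
    invFun := limitClassesExtend φ hφ
    left_inv := limitClassesExtend_h2PowCompatibleRestrict φ hφ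
    right_inv := h2PowCompatibleRestrict_limitClassesExtend φ hφ }

/-- Components of the bridge. [cite: MochizukiAbsTopIII2015, Cor 1.10 (i) p.42] -/
@[simp] theorem h2PowCompatibleEquivLimitClasses_apply_coe (c : H2PowCompatible k) (i : ℕ) :
    (h2PowCompatibleEquivLimitClasses φ hφ c :
        ∀ i, continuousCohomology 2 ((galCyclotomeTower φ hφ).obj i)) i =
      (c : ∀ n : ℕ+, continuousCohomology 2 (mu k (n : ℕ)).toTopRep) (cycLevel i) := rfl

/-- Components of the inverse bridge (at any admissible level). [cite: MochizukiAbsTopIII2015, Cor 1.10 (i) p.42] -/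
theorem h2PowCompatibleEquivLimitClasses_symm_apply_coe (s : (galCyclotomeTower φ hφ).limitClasses)
    (n : ℕ+) {i : ℕ} (hi : (n : ℕ) ∣ (cycLevel i : ℕ)) :
    ((h2PowCompatibleEquivLimitClasses φ hφ).symm s :
        ∀ n : ℕ+, continuousCohomology 2 (mu k (n : ℕ)).toTopRep) n =
      (cohomologyMap (muPowHomOfDvd k hi) 2).hom
        ((s : ∀ i, continuousCohomology 2 ((galCyclotomeTower φ hφ).obj i)) i) :=
  limitClassesExtend_apply_coe φ hφ s n hi

/-- The projection `μ_Ẑ(G_k) → μ_n(k̄)` factors through any level `N` with `n ∣ N`: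
`(proj_N z)^{N/n} = proj_n z`. [cite: MochizukiAbsTopIII2015, Cor 1.10 (i) p.42] -/
theorem muPowHomOfDvd_hom_cycProj_hom {n N : ℕ+} (h : (n : ℕ) ∣ (N : ℕ))
    (z : galCyclotomeTopRep (absoluteGaloisGroup k)) :
    (muPowHomOfDvd k h).hom ((cycProj φ hφ N).hom z) = (cycProj φ hφ n).hom z :=
  muVal_injective k n (by
    rw [muVal_muPowHomOfDvd_hom, muVal_cycProj_hom, muVal_cycProj_hom, componentUnit_eq_pow_of_dvd φ h])

/-- On `H²`: `H²(μ_N ↠ μ_n) ∘ H²(proj_N) = H²(proj_n)`. [cite: MochizukiAbsTopIII2015, Cor 1.10 (i) p.42] -/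
theorem cohomologyMap_muPowHomOfDvd_cycProj {n N : ℕ+} (h : (n : ℕ) ∣ (N : ℕ)) (q : ℕ)
    (x : continuousCohomology q (galCyclotomeTopRep (absoluteGaloisGroup k))) :
    (cohomologyMap (muPowHomOfDvd k h) q).hom ((cohomologyMap (cycProj φ hφ N) q).hom x) =
      (cohomologyMap (cycProj φ hφ n) q).hom x :=
  (cohomologyMap_hom_apply_of_comp _ _ _ (fun z => (muPowHomOfDvd_hom_cycProj_hom φ hφ h z).symm) q x).symm

end Bridge

/-! ### The MLF case: `H²(G_K, μ_Ẑ(G_K)) ≃+ lim_{n ∈ ℕ≥1} H²(G_K, μ_n)` canonically -/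

section MLF

variable (K : Type u) [Field K] [ValuativeRel K] [TopologicalSpace K] [IsNonarchimedeanLocalField K]
  [CharZero K]

variable (φ : muQZ (absoluteGaloisGroup K) ≃+ Additive (CommGroup.torsion (AlgebraicClosure K)ˣ))
  (hφ : ∀ (σ : absoluteGaloisGroup K) (x : muQZ (absoluteGaloisGroup K)),
    (((Additive.toMul (φ (σ • x)) : CommGroup.torsion (AlgebraicClosure K)ˣ) :
        (AlgebraicClosure K)ˣ) : AlgebraicClosure K) =
      σ • (((Additive.toMul (φ x) : CommGroup.torsion (AlgebraicClosure K)ˣ) :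
        (AlgebraicClosure K)ˣ) : AlgebraicClosure K))

/-- **`H²(G_K, μ_Ẑ(G_K)) ≃+ lim_{n ∈ ℕ≥1} H²(G_K, μ_n(K̄))`** for a `p`-adic local field `K` (given the
equivariant identification `φ : μ_{ℚ/ℤ}(G_K) ≅ μ(K̄)`): abc-iut-L4-t17's `limitClassesEquiv` for
`galCyclotomeTower` (NSW (2.7.6), `H¹(G_K, μ_n)` finite) followed by the cofinality bridge.
[cite: MochizukiAbsTopIII2015, Cor 1.10 (i) p.42] -/
def galCyclotomeH2EquivPowCompatible :
    galCyclotomeH2 (absoluteGaloisGroup K) ≃+ H2PowCompatible K :=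
  ((galCyclotomeTower φ hφ).limitClassesEquiv (finite_H1_galCyclotomeTower K φ hφ)).trans
    (h2PowCompatibleEquivLimitClasses φ hφ).symm

/-- **Canonical component formula**: the `n`-th component of the class of `c ∈ H²(G_K, μ_Ẑ(G_K))` in the
divisibility system is `H²(proj_n) c`, for EVERY positive level `n` (not only the factorial ones).
[cite: MochizukiAbsTopIII2015, Cor 1.10 (i) p.42] -/
@[simp] theorem galCyclotomeH2EquivPowCompatible_apply_coe (c : galCyclotomeH2 (absoluteGaloisGroup K))
    (n : ℕ+) :
    (galCyclotomeH2EquivPowCompatible K φ hφ c : ∀ n : ℕ+, continuousCohomology 2 (mu K (n : ℕ)).toTopRep) n =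
      (cohomologyMap (cycProj φ hφ n) 2).hom c := by
  change ((h2PowCompatibleEquivLimitClasses φ hφ).symm
      ((galCyclotomeTower φ hφ).limitClassesEquiv (finite_H1_galCyclotomeTower K φ hφ) c) :
    ∀ n : ℕ+, continuousCohomology 2 (mu K (n : ℕ)).toTopRep) n = _
  rw [h2PowCompatibleEquivLimitClasses_symm_apply_coe φ hφ _ n (dvd_cycLevel_natPred n),
    DiscreteTowerPresentation.limitClassesEquiv_apply_coe]
  exact cohomologyMap_muPowHomOfDvd_cycProj φ hφ (dvd_cycLevel_natPred n) 2 c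

/-- **The residue maps on the whole divisibility system**: for a power-compatible family `c`,
`inv_n c_n = (inv_N c_N mod n)` whenever `n ∣ N` (`invLevel_muPowHom_hom`, abc-iut-L4-t17 /
abc-iut-w5-d214), i.e. `(inv_n c_n)_n` is a `castHom`-compatible family in `∏_n ℤ/n`.
[cite: MochizukiAbsTopIII2015, Cor 1.10 (i) p.42] -/
theorem invLevel_castHom_of_mem_H2PowCompatible (c : H2PowCompatible K) {n N : ℕ+}
    (h : (n : ℕ) ∣ (N : ℕ)) :
    ZMod.castHom h (ZMod n)
        (Prop121vii.invLevel K N ((c : ∀ n : ℕ+, continuousCohomology 2 (mu K (n : ℕ)).toTopRep) N)) =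
      Prop121vii.invLevel K n ((c : ∀ n : ℕ+, continuousCohomology 2 (mu K (n : ℕ)).toTopRep) n) := by
  rw [← c.2 h]
  exact (invLevel_muPowHom_hom K (Nat.mul_div_cancel' h) _).symm

/-- abc-iut-L4-t17's `limitClassesEquivZModChain` on a restricted family reads `(inv_{(i+1)!} c_{(i+1)!})_i`.
[cite: MochizukiAbsTopIII2015, Cor 1.10 (i) p.42] -/
theorem limitClassesEquivZModChain_restrict_coe (c : H2PowCompatible K) (i : ℕ) :
    (limitClassesEquivZModChain K φ hφ (h2PowCompatibleRestrict φ hφ c)).1 i =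
      Prop121vii.invLevel K ((cycLevel i : ℕ+) : ℕ)
        ((c : ∀ n : ℕ+, continuousCohomology 2 (mu K (n : ℕ)).toTopRep) (cycLevel i)) := rfl

end MLF

end Literature.AnabelianGeometry.AbsoluteAnabelian

end
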